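import Mathlib
import Literature.Geometry.DiscreteGeometry.ThreePointKernelDimThree
import Literature.Geometry.DiscreteGeometry.ThreePointKernelGeneral
import HarnessLib

/-!
# Three-point blocks in MATRIX form: `⟨M, S_k⟩`-type blocks are nonnegative on triples for every positive semidefinite `M`

Framing: lottery ticket; floor = certified bounds/negative ranges. Venture `PackingBounds`, cell `pub-packcert`,
energy family E3PT (pub-packcert-energy gen 23; KERNEL-NF route, see `KERNEL-NF.md`).

The tree's factored three-point function `threePointF3` (and `tripleSum_threePointF3_nonneg`) takes each
Bachoc–Vallentin block in RANK-ONE form `Σ_r d_r · sym6 (g_r(u) g_r(v) Q3 k)` with weights `d_r ≥ 0`.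
For certificates over a number field the exact `LDLᵀ` producing that form has prohibitive height
(KERNEL-NF.md, gen-23 measurement), while positive semidefiniteness of the block MATRIX is cheap to
certify from integer data (`NFGramPSD`). This module closes the gap once and for all:

* `blockF3 k M P u v t = Σ_{i,j} M i j · sym6 (P i (·) ⊗ P j (·) · Q3 k) u v t` — a block in matrix form
  with arbitrary weight functions `P i : ℝ → ℝ` (in applications: a polynomial basis);
* `tripleSum_blockF3_nonneg` — for `M` positive semidefinite and unit vectors `C ⊂ ℝ³`,
  `0 ≤ tripleSum C (blockF3 k M P)`.

Proof: `M = R·R` with `R = CFC.sqrt M` symmetric (Mathlib's C⋆-algebraic square root in the Loewner order),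
so `blockF3 k M P = Σ_l sym6 (g_l ⊗ g_l · Q3 k)` with `g_l = Σ_i R l i · P i`, and each summand is
nonnegative on triples by `tripleSum_sym6_weight_nonneg3` [cite: BachocVallentin2007, (pos Y) / Cor. 3.4].
A companion `posSemidef_of_quadForm` turns the quadratic-form conclusion of `NFGramPSD`/`GramData` checkers
into `Matrix.PosSemidef`.
-/

noncomputable section

open Finset Matrix
open scoped MatrixOrder

namespace Summit.Ventures.PackingBounds.Energy.ThreePointMatrix

open Literature.Geometry.DiscreteGeometry Literature.Geometry.DiscreteGeometry.BachocVallentin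
open Literature.Analysis.SpecialFunctions

variable {m : Type*} [Fintype m]

/-- A three-point block in matrix form: `Σ_{i,j} M i j · sym6 (u v t ↦ P i u · P j v · Q3 k u v t)`. -/
def blockF3 (k : ℕ) (M : Matrix m m ℝ) (P : m → ℝ → ℝ) (u v t : ℝ) : ℝ :=
  ∑ i, ∑ j, M i j * sym6 (fun u v t => P i u * P j v * Q3 k u v t) u v t

/-- A real matrix whose quadratic form is nonnegative and which is symmetric is positive semidefinite
(bridge from the `∀ y, 0 ≤ Σ_{i,j} M i j · y i · y j` conclusions of the tree's integer-data checkers). -/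
theorem posSemidef_of_quadForm (M : Matrix m m ℝ) (hsym : ∀ i j, M i j = M j i)
    (hq : ∀ y : m → ℝ, 0 ≤ ∑ i, ∑ j, M i j * y i * y j) : M.PosSemidef := by
  refine PosSemidef.of_dotProduct_mulVec_nonneg ?_ ?_
  · ext i j
    simpa [conjTranspose_apply] using hsym j i
  · intro x
    have h := hq x
    have hx : star x ⬝ᵥ (M *ᵥ x) = ∑ i, ∑ j, M i j * x i * x j := by
      simp only [dotProduct, mulVec, star_trivial, Finset.mul_sum]
      refine Finset.sum_congr rfl fun i _ => Finset.sum_congr rfl fun j _ => ?_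
      ring
    rw [hx]; exact h

/-- `R = CFC.sqrt M` is symmetric. -/
private theorem sqrt_transpose [DecidableEq m] (M : Matrix m m ℝ) : (CFC.sqrt M)ᵀ = CFC.sqrt M := by
  have hH : (CFC.sqrt M).IsHermitian := (CFC.sqrt_nonneg M).isSelfAdjoint
  have h : (CFC.sqrt M)ᴴ = CFC.sqrt M := hH.eq
  rwa [conjTranspose_eq_transpose_of_trivial] at h

/-- `R·R = M` for positive semidefinite `M`, `R = CFC.sqrt M`. -/
private theorem sqrt_mul_sqrt [DecidableEq m] (M : Matrix m m ℝ) (hM : M.PosSemidef) : CFC.sqrt M * CFC.sqrt M = M :=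
  CFC.sqrt_mul_sqrt_self M (ha := Matrix.nonneg_iff_posSemidef.mpr hM)

/-- Entries of a positive semidefinite matrix through its square root: `M i j = Σ_l R l i · R l j`. -/
private theorem entry_eq_sum_sqrt [DecidableEq m] (M : Matrix m m ℝ) (hM : M.PosSemidef) (i j : m) :
    M i j = ∑ l, (CFC.sqrt M) l i * (CFC.sqrt M) l j := by
  have h := sqrt_mul_sqrt M hM
  have hij := congrFun (congrFun h i) j
  rw [Matrix.mul_apply] at hij
  rw [← hij]
  refine Finset.sum_congr rfl fun l _ => ?_
  have ht := congrFun (congrFun (sqrt_transpose M) l) i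
  rw [transpose_apply] at ht
  rw [ht]

/-- The algebraic step: a symmetric-square-root expansion of one `sym6` summand pattern. -/
private theorem sum_sum_factor (R : Matrix m m ℝ) (a b : m → ℝ) (q : ℝ) :
    (∑ i, ∑ j, (∑ l, R l i * R l j) * (a i * b j * q)) = ∑ l, (∑ i, R l i * a i) * (∑ j, R l j * b j) * q := by
  have h1 : (∑ i, ∑ j, (∑ l, R l i * R l j) * (a i * b j * q))
      = ∑ i, ∑ j, ∑ l, R l i * a i * (R l j * b j) * q := by
    refine Finset.sum_congr rfl fun i _ => Finset.sum_congr rfl fun j _ => ?_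
    rw [Finset.sum_mul]
    refine Finset.sum_congr rfl fun l _ => ?_
    ring
  have h2 : (∑ l, (∑ i, R l i * a i) * (∑ j, R l j * b j) * q)
      = ∑ l, ∑ i, ∑ j, R l i * a i * (R l j * b j) * q := by
    refine Finset.sum_congr rfl fun l _ => ?_
    rw [Finset.sum_mul_sum, Finset.sum_mul]
    refine Finset.sum_congr rfl fun i _ => ?_
    rw [Finset.sum_mul]
  rw [h1, h2]
  have h3 : (∑ i, ∑ j, ∑ l, R l i * a i * (R l j * b j) * q) = ∑ i, ∑ l, ∑ j, R l i * a i * (R l j * b j) * q := by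
    refine Finset.sum_congr rfl fun i _ => ?_
    rw [Finset.sum_comm]
  rw [h3, Finset.sum_comm]

/-- **Matrix form = sum of rank-one forms through the square root:** for positive semidefinite `M`,
`blockF3 k M P u v t = Σ_l sym6 (g_l ⊗ g_l · Q3 k) u v t` with `g_l x = Σ_i (CFC.sqrt M) l i · P i x`. -/
theorem blockF3_eq_sum_sqrt [DecidableEq m] (k : ℕ) (M : Matrix m m ℝ) (hM : M.PosSemidef) (P : m → ℝ → ℝ) (u v t : ℝ) :
    blockF3 k M P u v t = ∑ l, sym6 (fun u v t => (∑ i, (CFC.sqrt M) l i * P i u) * (∑ j, (CFC.sqrt M) l j * P j v) * Q3 k u v t) u v t := by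
  unfold blockF3
  have hM' : ∀ i j, M i j = ∑ l, (CFC.sqrt M) l i * (CFC.sqrt M) l j := entry_eq_sum_sqrt M hM
  simp only [sym6, hM']
  simp only [mul_add, Finset.sum_add_distrib]
  simp only [sum_sum_factor]

/-- **Three-point blocks in matrix form are nonnegative on triples:** for a positive semidefinite real matrix `M`,
arbitrary weight functions `P i`, every `k`, and unit vectors `C ⊂ ℝ³`, `0 ≤ tripleSum C (blockF3 k M P)`.
[cite: BachocVallentin2007, Cor. 3.4 / (pos Y)] via `tripleSum_sym6_weight_nonneg3` and `M = (CFC.sqrt M)²`. -/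
theorem tripleSum_blockF3_nonneg [DecidableEq m] (k : ℕ) (M : Matrix m m ℝ) (hM : M.PosSemidef) (P : m → ℝ → ℝ)
    (C : Finset (EuclideanSpace ℝ (Fin 3))) (hC : ∀ x ∈ C, ‖x‖ = 1) :
    0 ≤ tripleSum C (blockF3 k M P) := by
  have hfun : blockF3 k M P = fun u v t => ∑ l ∈ (Finset.univ : Finset m),
      sym6 (fun u v t => (∑ i, (CFC.sqrt M) l i * P i u) * (∑ j, (CFC.sqrt M) l j * P j v) * Q3 k u v t) u v t := by
    funext u v t; exact blockF3_eq_sum_sqrt k M hM P u v t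
  rw [hfun, tripleSum_finset_sum]
  refine Finset.sum_nonneg fun l _ => ?_
  exact tripleSum_sym6_weight_nonneg3 k (fun x => ∑ i, (CFC.sqrt M) l i * P i x) C hC

/-- The same from the quadratic-form hypotheses delivered by the integer-data checkers (`GramData` / `NFGram`). -/
theorem tripleSum_blockF3_nonneg_of_quadForm [DecidableEq m] (k : ℕ) (M : Matrix m m ℝ) (hsym : ∀ i j, M i j = M j i)
    (hq : ∀ y : m → ℝ, 0 ≤ ∑ i, ∑ j, M i j * y i * y j) (P : m → ℝ → ℝ)
    (C : Finset (EuclideanSpace ℝ (Fin 3))) (hC : ∀ x ∈ C, ‖x‖ = 1) :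
    0 ≤ tripleSum C (blockF3 k M P) :=
  tripleSum_blockF3_nonneg k M (posSemidef_of_quadForm M hsym hq) P C hC

/-- `blockF3` is symmetric in its first two arguments (each `sym6` is). -/
theorem blockF3_swap12 (k : ℕ) (M : Matrix m m ℝ) (P : m → ℝ → ℝ) (u v t : ℝ) :
    blockF3 k M P u v t = blockF3 k M P v u t := by
  unfold blockF3
  refine Finset.sum_congr rfl fun i _ => Finset.sum_congr rfl fun j _ => ?_
  rw [sym6_swap12]

/-- `blockF3` is symmetric in its last two arguments (each `sym6` is). -/
theorem blockF3_swap23 (k : ℕ) (M : Matrix m m ℝ) (P : m → ℝ → ℝ) (u v t : ℝ) :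
    blockF3 k M P u v t = blockF3 k M P u t v := by
  unfold blockF3
  refine Finset.sum_congr rfl fun i _ => Finset.sum_congr rfl fun j _ => ?_
  rw [sym6_swap23]

/-! ### The same in every dimension `n ≥ 4` (kernel `Q n k` of `ThreePointKernelGeneral`) -/

/-- A three-point block in matrix form on `S^{n-1}`: `Σ_{i,j} M i j · sym6 (u v t ↦ P i u · P j v · Q n k u v t)`. -/
def blockF {n : ℕ} (k : ℕ) (M : Matrix m m ℝ) (P : m → ℝ → ℝ) (u v t : ℝ) : ℝ :=
  ∑ i, ∑ j, M i j * sym6 (fun u v t => P i u * P j v * Q n k u v t) u v t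

/-- Matrix form = sum of rank-one forms through the square root, dimension `n`. -/
theorem blockF_eq_sum_sqrt [DecidableEq m] {n : ℕ} (k : ℕ) (M : Matrix m m ℝ) (hM : M.PosSemidef) (P : m → ℝ → ℝ) (u v t : ℝ) :
    blockF (n := n) k M P u v t = ∑ l, sym6 (fun u v t => (∑ i, (CFC.sqrt M) l i * P i u) * (∑ j, (CFC.sqrt M) l j * P j v) * Q n k u v t) u v t := by
  unfold blockF
  have hM' : ∀ i j, M i j = ∑ l, (CFC.sqrt M) l i * (CFC.sqrt M) l j := entry_eq_sum_sqrt M hM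
  simp only [sym6, hM']
  simp only [mul_add, Finset.sum_add_distrib]
  simp only [sum_sum_factor]

/-- **Three-point blocks in matrix form are nonnegative on triples, every dimension `n ≥ 4`:**
for a positive semidefinite real matrix `M`, arbitrary weight functions `P i`, every `k`, and unit vectors `C ⊂ ℝⁿ`,
`0 ≤ tripleSum C (blockF k M P)`. [cite: BachocVallentin2007, Corollary 3.5] via `tripleSum_sym6_weight_nonneg`. -/
theorem tripleSum_blockF_nonneg [DecidableEq m] {n : ℕ} (hn : 4 ≤ n) (k : ℕ) (M : Matrix m m ℝ) (hM : M.PosSemidef)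
    (P : m → ℝ → ℝ) (C : Finset (EuclideanSpace ℝ (Fin n))) (hC : ∀ x ∈ C, ‖x‖ = 1) :
    0 ≤ tripleSum C (blockF (n := n) k M P) := by
  have hfun : blockF (n := n) k M P = fun u v t => ∑ l ∈ (Finset.univ : Finset m),
      sym6 (fun u v t => (∑ i, (CFC.sqrt M) l i * P i u) * (∑ j, (CFC.sqrt M) l j * P j v) * Q n k u v t) u v t := by
    funext u v t; exact blockF_eq_sum_sqrt k M hM P u v t
  rw [hfun, tripleSum_finset_sum]
  refine Finset.sum_nonneg fun l _ => ?_
  exact tripleSum_sym6_weight_nonneg hn k (fun x => ∑ i, (CFC.sqrt M) l i * P i x) C hC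

/-- The same from quadratic-form hypotheses (integer-data checkers), every dimension `n ≥ 4`. -/
theorem tripleSum_blockF_nonneg_of_quadForm [DecidableEq m] {n : ℕ} (hn : 4 ≤ n) (k : ℕ) (M : Matrix m m ℝ)
    (hsym : ∀ i j, M i j = M j i) (hq : ∀ y : m → ℝ, 0 ≤ ∑ i, ∑ j, M i j * y i * y j) (P : m → ℝ → ℝ)
    (C : Finset (EuclideanSpace ℝ (Fin n))) (hC : ∀ x ∈ C, ‖x‖ = 1) :
    0 ≤ tripleSum C (blockF (n := n) k M P) :=
  tripleSum_blockF_nonneg hn k M (posSemidef_of_quadForm M hsym hq) P C hC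

end Summit.Ventures.PackingBounds.Energy.ThreePointMatrix
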